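import Literature.Computability.Complexity.SearchToDecisionBPP
import Literature.Computability.Complexity.PlumbingBricks
import Literature.Computability.Complexity.IPOptimumLeafFP
import Literature.Computability.Complexity.CodeFPArith
import Literature.Computability.Complexity.LengthCompare
import Literature.Computability.MetaComplexity.OnesZeroPadRefuters
import HarnessLib

/-!
# Logarithmic advice does not help `NP`: `NP ⊆ P/log ⟹ P = NP` (Karp–Lipton 1980)

Reproduction, over the tree's certificate calculus, of the `P/log` half of Karp–Lipton's STOC 1980
paper *Some connections between nonuniform and uniform complexity classes*
(doi:10.1145/800141.804678): **if `NP` has polynomial-time algorithms taking `O(log n)` bits of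
advice, then `P = NP`** — in the textbooks as Homer–Selman, *Computability and Complexity Theory*
(2nd ed., Springer 2011), Homework 8.13: "Use the self-reducibility of SAT to prove that
`NP ⊆ P/log` implies `P = NP`", with `log = {f : ℕ → Σ* | |f(n)| ≤ O(log n)}` (ibid.); see also
Balcázar–Schöning, *Logarithmic advice classes*, Theoret. Comput. Sci. 99 (1992) 279–290.

`P/log`. Following the tree's `polyAdvice` (`CircuitClasses.lean`, Arora–Barak Def. 6.16) with the
polynomial advice bound replaced by `c·⌊log₂ n⌋ + c`, "`T ∈ P/log`" is written out in every
statement as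

  `∃ T' ∈ P, ∃ a : ℕ → {0,1}*, ∃ c, (∀ n, |a n| ≤ c·log₂ n + c) ∧ ∀ y, (y ∈ T ↔ ⟨y, a |y|⟩ ∈ T')`

(no new definition is introduced; `⟨·,·⟩ = boolPair`).

## The proof and its rendering

The textbook argument: given `x`, for each of the polynomially many candidate advice strings `s`
run the downward self-reduction of `SAT` with the `P/log` machine and advice `s` as the oracle, and
accept iff some run ends in a verified satisfying assignment; with the true advice the run is
correct, and verification makes wrong advice harmless. Two points need care and are where this
file does its work.

* *One advice string must serve all oracle queries of a run*, so all queries must have the same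
  length. We therefore state the theorem for an `NP`-hard **length-paddable** language `T`
  (`IsLengthPaddable`, `MetaComplexity/ConstructiveSeparations.lean`: a polynomial-time `pad (y, m)`
  of length exactly `m ≥ |y|` with the same membership) and pad every query to the common length
  `N(|x|) = F(Q(|x|))`, `Q(n) = 2n + 3 + p(n)` bounding the queries and `F` the stretch of the
  reduction. The tree's `SAT` has a rigid encoding and is not length-paddable, but
  `onesZeroPad SAT = {1ⁱ 0 φ : φ ∈ SAT}` is, and is `NP`-complete (`OnesZeroPadRefuters.lean`), which
  gives the class statement `NP ⊆ P/log → NP ⊆ P`.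
* *The search.* Instead of `SAT`'s self-reduction we use the tree's generic bit-by-bit certificate
  search RELATIVE TO AN ORACLE with a parameter carried in the instance
  (`SearchToDecisionBPP.lean`, written there for coin strings: `searchFnD`, `coinRel`, `coinOrc`,
  and `searchFnD_coins_spec` — "if the parameter answers the `p(|x|)+1` canonical extension queries
  correctly, the run returns a certificate"). For `L ∈ NP` with verifier `R ∈ P` and bound `p`, the
  extension language `SuffExt R p ∈ NP` (`SearchToDecision.lean`) Karp-reduces to `T` by `f`; the
  oracle with parameter `s` answers a query `q` by `⟨pad (f q, N(|x|)), s⟩ ∈ T'`; for `s = a(N(|x|))`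
  every answer is correct. The candidates `s` are `natBits k m`, `k ≤ c·N + c`, `m < 2ᶜ(N+1)ᶜ`
  (`Nat.log 2 N ≤ N`, `2^{⌊log₂ N⌋} ≤ N + 1`), enumerated and tested inside the typed
  polynomial-time algebra `CodeFP` (`urange`, `CodeFP.any`, `IPVerifier.natBitsC`); the accepting
  set is in `P` by `mem_P_of_mem_FP` and equals `L`.

## Main statements

* `NP_subset_P_of_isHard_lengthPaddable_logAdvice` — an `NP`-hard length-paddable `T ∈ P/log`
  gives `NP ⊆ P`;
* `NP_subset_P_of_NP_subset_logAdvice` — `NP ⊆ P/log → NP ⊆ P`; `NP_subset_logAdvice_iff` — `↔`;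
* `mem_logAdvice_iff_of_isNPComplete_lengthPaddable` — for `NP`-complete length-paddable `T`:
  `T ∈ P/log ↔ NP ⊆ P`; `onesZeroPad_SAT_mem_logAdvice_iff`.

The contrast that makes this worth recording next to `KarpLipton.lean` (`NP ⊆ P/poly → PH = Σ₂ᵖ`):
logarithmic advice is absorbed by `P` outright, polynomial advice only collapses the hierarchy.

## References

* R. M. Karp, R. J. Lipton, *Some connections between nonuniform and uniform complexity classes*,
  Proc. 12th STOC (1980) 302–309, doi:10.1145/800141.804678 (`P/log`; the `P/poly` theorem is
  Thm. 6.1 there). [KarpLipton1980]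
* S. Homer, A. L. Selman, *Computability and Complexity Theory*, 2nd ed., Springer 2011,
  doi:10.1007/978-1-4614-0682-2, §8 (definition of `log`, Homework 8.13).
* J. L. Balcázar, U. Schöning, *Logarithmic advice classes*, Theoret. Comput. Sci. 99 (1992)
  279–290, doi:10.1016/0304-3975(92)90353-H.
* S. Arora, B. Barak, *Computational Complexity: A Modern Approach*, CUP 2009, Def. 6.16 (advice),
  Thm. 2.18 (search from decision). [AroraBarak2009]
-/

noncomputable section

namespace Literature.Computability.Complexity

open _root_.Computability Polynomial CodeFP
open Literature.Computability.MetaComplexity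
open scoped Notation

/-! ### Two arithmetic facts about the advice bound -/

/-- `2^{c·⌊log₂ N⌋ + c} ≤ 2ᶜ · (N + 1)ᶜ`. [folklore] -/
theorem two_pow_mul_log_add_le (c N : ℕ) : 2 ^ (c * Nat.log 2 N + c) ≤ 2 ^ c * (N + 1) ^ c := by
  have h1 : 2 ^ Nat.log 2 N ≤ N + 1 := Nat.pow_log_le_add_one 2 N
  calc 2 ^ (c * Nat.log 2 N + c) = (2 ^ Nat.log 2 N) ^ c * 2 ^ c := by rw [pow_add, pow_mul']
    _ ≤ (N + 1) ^ c * 2 ^ c := Nat.mul_le_mul_right _ (Nat.pow_le_pow_left h1 c)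
    _ = 2 ^ c * (N + 1) ^ c := mul_comm _ _

/-- `c·⌊log₂ N⌋ + c ≤ c·N + c`. [folklore] -/
theorem mul_log_add_le (c N : ℕ) : c * Nat.log 2 N + c ≤ c * N + c :=
  Nat.add_le_add_right (Nat.mul_le_mul_left c (Nat.log_le_self 2 N)) c

/-! ### The theorem -/

/-- **An `NP`-hard length-paddable language with a `P/log` algorithm gives `P = NP`**
(Karp–Lipton 1980; Homer–Selman 2011, Homework 8.13, for `SAT`). Hypotheses: `T` is `NP`-hard
under Karp reductions, length-paddable, and `T ∈ P/log` written out (`T' ∈ P` the advice-taking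
machine, `a` the advice, `|a n| ≤ c·⌊log₂ n⌋ + c`). Conclusion: `NP ⊆ P`.
[cite: KarpLipton1980, §6 (P/log)] [cite: AroraBarak2009, Thm. 2.18 and Def. 6.16] -/
theorem NP_subset_P_of_isHard_lengthPaddable_logAdvice {T : Language Bool}
    (hT : IsHard Nondeterministic.NP T) (hpad : IsLengthPaddable T)
    (hlog : ∃ T' ∈ Classes.P, ∃ a : ℕ → List Bool, ∃ c : ℕ,
      (∀ n, (a n).length ≤ c * Nat.log 2 n + c) ∧ ∀ y, y ∈ T ↔ boolPair y (a y.length) ∈ T') :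
    Nondeterministic.NP ⊆ Classes.P := by
  classical
  obtain ⟨T', hT'P, a, c, ha, hadv⟩ := hlog
  obtain ⟨pad, hpadFP, hpadspec⟩ := hpad
  intro L hL
  obtain ⟨R, hR, p, hver⟩ := hL
  -- the extension language of `R` Karp-reduces to `T`, with a polynomial stretch `F`
  obtain ⟨f, hf, hfred⟩ := hT (SuffExt R p) (SuffExt_mem_NP R p hR)
  obtain ⟨F, hF⟩ := exists_poly_length_le_of_mem_FP hf
  -- unary polynomial clocks on codes
  have hpolyU : ∀ P : Polynomial ℕ, CodeFP unE unE (fun n => P.eval n) := fun P =>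
    ⟨Plumb.polyFn P, Plumb.polyFn_mem_FP P, fun n => by
      rw [Plumb.polyFn_apply, length_unE, unE_eq_ones]⟩
  -- the polynomials: query bound `Q`, common padded length `N`, advice-length bound `PK`,
  -- number of advice values `PM`
  obtain ⟨Q, hQ⟩ : ∃ Q : Polynomial ℕ, ∀ n, Q.eval n = 2 * n + 3 + p.eval n :=
    ⟨2 * X + 3 + p, fun n => by simp⟩
  obtain ⟨N, hN⟩ : ∃ N : Polynomial ℕ, ∀ n, N.eval n = F.eval (Q.eval n) :=
    ⟨F.comp Q, fun n => eval_comp⟩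
  obtain ⟨PK, hPK⟩ : ∃ PK : Polynomial ℕ, ∀ n, PK.eval n = c * N.eval n + c :=
    ⟨C c * N + C c, fun n => by simp⟩
  obtain ⟨PM, hPM⟩ : ∃ PM : Polynomial ℕ, ∀ n, PM.eval n = 2 ^ c * (N.eval n + 1) ^ c :=
    ⟨C (2 ^ c) * (N + 1) ^ c, fun n => by simp⟩
  -- Step 1: the oracle-side map `⟨⟨x, w⟩, s⟩ ↦ ⟨pad (f ⟨x, w⟩, N(|x|)), s⟩` is in `FP`
  obtain ⟨g, hg, hgq⟩ : ∃ g : List Bool → List Bool, g ∈ FP ∧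
      ∀ x w s : List Bool, g (boolPair (boolPair x w) s) =
        boolPair (pad (f (boolPair x w), N.eval x.length)) s := by
    -- the typed map `u = ⟨q, s⟩ ↦ (f q, N(|(boolUnpair q).1|))` into codes of `{0,1}* × ℕ`
    have hkC : CodeFP strE (pairE strE unE)
        (fun u => (f (boolUnpair u).1, N.eval (boolUnpair (boolUnpair u).1).1.length)) := by
      refine ⟨fanoutFn (f ∘ fun z => (boolUnpair z).1)
          (Plumb.polyFn N ∘ (fun z => (boolUnpair z).1) ∘ fun z => (boolUnpair z).1),
        fanoutFn_mem_FP (comp_mem_FP hf boolUnpairFst_mem_FP)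
          (comp_mem_FP (Plumb.polyFn_mem_FP N) (comp_mem_FP boolUnpairFst_mem_FP boolUnpairFst_mem_FP)),
        fun u => ?_⟩
      simp only [fanoutFn_apply, Function.comp_apply, Plumb.polyFn_apply, pairE_apply, strE, id_eq,
        unE_eq_ones]
    have hk := hkC.polyTimeComputable
    have hcomp := PolyTimeComputable.comp_holds hpadFP hk
    refine ⟨fanoutFn (pad ∘ fun u => (f (boolUnpair u).1, N.eval (boolUnpair (boolUnpair u).1).1.length))
        (fun z => (boolUnpair z).2), fanoutFn_mem_FP hcomp boolUnpairSnd_mem_FP, fun x w s => ?_⟩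
    simp only [fanoutFn_apply, Function.comp_apply, boolUnpair_boolPair]
  -- Step 2: the oracle language `g ⁻¹' T' ∈ P` and the search function relative to it
  have hLoP : (g ⁻¹' T' : Language Bool) ∈ Classes.P := preimage_mem_P hT'P hg
  obtain ⟨B, hB, hfind⟩ : ∃ B : List Bool → List Bool, B ∈ FP ∧ ∀ x ∈ L,
      (B (boolPair x (a (N.eval x.length)))).length ≤ p.eval x.length ∧
        boolPair x (B (boolPair x (a (N.eval x.length)))) ∈ R := by
    refine ⟨searchFnD (coinRel R p) (coinOrc (g ⁻¹' T')) p,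
      searchFnD_mem_FP _ _ _ (coinRel_mem_P R p hR) (coinOrc_mem_P _ hLoP), fun x hx => ?_⟩
    have hsol : ∃ y : List Bool, y.length ≤ p.eval x.length ∧ boolPair x y ∈ R := (hver x).1 hx
    refine searchFnD_coins_spec hsol fun j hj => ?_
    -- the `j`-th canonical query, its image under the reduction, padded to length `N(|x|)`
    have hqlen : (f (boolPair x (false :: canon R p x j))).length ≤ N.eval x.length := by
      have h1 : (boolPair x (false :: canon R p x j)).length ≤ Q.eval x.length := by
        rw [length_boolPair, List.length_cons, hQ]
        have := length_canon_le hsol j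
        omega
      rw [hN]
      exact (hF _).trans (TM2Iter.eval_mono F h1)
    obtain ⟨hpl, hpm⟩ := hpadspec _ _ hqlen
    have h2 := hadv (pad (f (boolPair x (false :: canon R p x j)), N.eval x.length))
    rw [hpl] at h2
    change g _ ∈ T' ↔ _
    rw [hgq, ← h2, hpm]
    exact (hfred _).symm
  -- Step 3: the candidate test `V (x, s)`: run the search with parameter `s` and verify
  obtain ⟨V, hV1, hV2, hVC⟩ : ∃ V : List Bool × List Bool → Bool,
      (∀ x s, V (x, s) = true → x ∈ L) ∧ (∀ x ∈ L, V (x, a (N.eval x.length)) = true) ∧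
        CodeFP (pairE strE strE) bitE V := by
    refine ⟨fun t => decide ((B (boolPair t.1 t.2)).length ≤ p.eval t.1.length) &&
        R.boolIndicator (boolPair t.1 (B (boolPair t.1 t.2))), fun x s h => ?_, fun x hx => ?_, ?_⟩
    · simp only [Bool.and_eq_true, decide_eq_true_eq] at h
      exact (hver x).2 ⟨_, h.1, (Set.mem_iff_boolIndicator _ _).2 h.2⟩
    · obtain ⟨h1, h2⟩ := hfind x hx
      simp only [Bool.and_eq_true, decide_eq_true_eq]
      exact ⟨h1, (Set.mem_iff_boolIndicator _ _).1 h2⟩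
    · have hBC : CodeFP (pairE strE strE) strE (fun t => B (boolPair t.1 t.2)) := ⟨B, hB, fun _ => rfl⟩
      have hlen : CodeFP (pairE strE strE) natE (fun t => (B (boolPair t.1 t.2)).length) :=
        (natOfUn.comp (strLength.comp hBC) :)
      have hpx : CodeFP (pairE strE strE) natE (fun t => p.eval t.1.length) :=
        (natOfUn.comp ((hpolyU p).comp (strLength.comp (CodeFP.fst _ _))) :)
      have hle : CodeFP (pairE strE strE) bitE
          (fun t => decide ((B (boolPair t.1 t.2)).length ≤ p.eval t.1.length)) :=
        (natLe.comp (hlen.pair hpx) :)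
      have hRC : CodeFP strE bitE (fun z => R.boolIndicator z) :=
        ⟨fun z => encodeBool (R.boolIndicator z), indicatorFn_mem_FP hR, fun _ => rfl⟩
      have hXB : CodeFP (pairE strE strE) strE (fun t => boolPair t.1 (B (boolPair t.1 t.2))) :=
        ((CodeFP.fst _ _).pair hBC).recodeOut fun _ => rfl
      exact hle.and (hRC.comp hXB)
  -- Step 4: the decision procedure: try all `natBits k m`, `k ≤ PK(|x|)`, `m < PM(|x|)`
  obtain ⟨Dec, hDec1, hDec2, hDecC⟩ : ∃ Dec : List Bool → Bool,
      (∀ x, Dec x = true → x ∈ L) ∧ (∀ x ∈ L, Dec x = true) ∧ CodeFP strE bitE Dec := by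
    refine ⟨fun x => (List.range (PK.eval x.length + 1)).any fun k =>
        (List.range (PM.eval x.length)).any fun m =>
          V (x, natBits (min k (PK.eval x.length + 1)) m), fun x h => ?_, fun x hx => ?_, ?_⟩
    · simp only [List.any_eq_true] at h
      obtain ⟨k, -, m, -, hm⟩ := h
      exact hV1 _ _ hm
    · have hr := ha (N.eval x.length)
      have hk : (a (N.eval x.length)).length < PK.eval x.length + 1 := by
        rw [hPK]; exact Nat.lt_succ_of_le (hr.trans (mul_log_add_le c _))
      have hm : bitsToNat (a (N.eval x.length)) < PM.eval x.length := by
        rw [hPM]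
        exact (bitsToNat_lt _).trans_le
          ((Nat.pow_le_pow_right Nat.two_pos hr).trans (two_pow_mul_log_add_le c _))
      simp only [List.any_eq_true, List.mem_range]
      refine ⟨_, hk, _, hm, ?_⟩
      rw [min_eq_left hk.le, IPVerifier.natBits_bitsToNat_of_length _ rfl]
      exact hV2 x hx
    · -- the test on a candidate `((x, k), m)`
      have hW : CodeFP (pairE (pairE strE unE) natE) bitE
          (fun t => V (t.1.1, natBits t.1.2 t.2)) :=
        (hVC.comp ((CodeFP.fst _ _).fst'.pair
          (IPVerifier.natBitsC.comp ((CodeFP.fst _ _).snd'.pair (CodeFP.snd _ _)))) :)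
      have hMl : CodeFP (pairE strE unE) (rawE natE) (fun t => List.range (PM.eval t.1.length)) :=
        (urange.comp ((hpolyU PM).comp (strLength.comp (CodeFP.fst _ _))) :)
      have hIn : CodeFP (pairE strE unE) bitE
          (fun t => (List.range (PM.eval t.1.length)).any fun m => V (t.1, natBits t.2 m)) :=
        ((CodeFP.any hW).comp ((CodeFP.id _).pair hMl) :)
      have hcap : CodeFP (pairE strE natE) unE (fun t => PK.eval t.1.length + 1) :=
        (unSucc.comp ((hpolyU PK).comp (strLength.comp (CodeFP.fst _ _))) :)
      have hInN : CodeFP (pairE strE natE) bitE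
          (fun t => (List.range (PM.eval t.1.length)).any fun m =>
            V (t.1, natBits (min t.2 (PK.eval t.1.length + 1)) m)) :=
        (hIn.comp ((CodeFP.fst _ _).pair (unOfNatMin.comp (hcap.pair (CodeFP.snd _ _)))) :)
      have hKl : CodeFP strE (rawE natE) (fun x => List.range (PK.eval x.length + 1)) :=
        (urange.comp (unSucc.comp ((hpolyU PK).comp strLength)) :)
      exact ((CodeFP.any hInN).comp ((CodeFP.id _).pair hKl) :)
  -- Step 5: `L = {x | Dec x}` is in `P`
  obtain ⟨d, hd, hdx⟩ := hDecC
  refine mem_P_of_mem_FP hd _ fun x => ⟨fun hx => ?_, fun hx => ?_⟩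
  · have := hdx x
    rw [hDec2 x hx] at this
    exact this
  · have := hdx x
    cases hD : Dec x with
    | true => exact absurd (hDec1 x hD) hx
    | false => rw [hD] at this; exact this

/-! ### Corollaries: the class statements -/

/-- **`NP ⊆ P/log ⟹ NP ⊆ P`** (Karp–Lipton 1980), through the `NP`-complete length-paddable
language `onesZeroPad SAT`. [cite: KarpLipton1980, §6 (P/log)] -/
theorem NP_subset_P_of_NP_subset_logAdvice
    (h : ∀ L ∈ Nondeterministic.NP, ∃ L' ∈ Classes.P, ∃ a : ℕ → List Bool, ∃ c : ℕ,
      (∀ n, (a n).length ≤ c * Nat.log 2 n + c) ∧ ∀ x, x ∈ L ↔ boolPair x (a x.length) ∈ L') :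
    Nondeterministic.NP ⊆ Classes.P :=
  NP_subset_P_of_isHard_lengthPaddable_logAdvice (isNPComplete_onesZeroPad isNPComplete_SAT_holds).2
    (isLengthPaddable_onesZeroPad SAT) (h _ (isNPComplete_onesZeroPad isNPComplete_SAT_holds).1)

/-- **`P ⊆ P/log`** with empty advice: `L' = {w | (boolUnpair w).1 ∈ L}`, `a n = ε`, `c = 0`.
[cite: AroraBarak2009, Def. 6.16 (remark `P ⊆ P/poly`)] -/
theorem mem_logAdvice_of_mem_P {L : Language Bool} (hL : L ∈ Classes.P) :
    ∃ L' ∈ Classes.P, ∃ a : ℕ → List Bool, ∃ c : ℕ,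
      (∀ n, (a n).length ≤ c * Nat.log 2 n + c) ∧ ∀ x, x ∈ L ↔ boolPair x (a x.length) ∈ L' := by
  refine ⟨(fun z => (boolUnpair z).1) ⁻¹' L, preimage_mem_P hL boolUnpairFst_mem_FP, fun _ => [], 0,
    fun n => by simp, fun x => ?_⟩
  change x ∈ L ↔ (boolUnpair (boolPair x [])).1 ∈ L
  rw [boolUnpair_boolPair]

/-- **`NP ⊆ P/log ↔ NP ⊆ P`.** [cite: KarpLipton1980, §6 (P/log)] -/
theorem NP_subset_logAdvice_iff :
    (∀ L ∈ Nondeterministic.NP, ∃ L' ∈ Classes.P, ∃ a : ℕ → List Bool, ∃ c : ℕ,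
      (∀ n, (a n).length ≤ c * Nat.log 2 n + c) ∧ ∀ x, x ∈ L ↔ boolPair x (a x.length) ∈ L') ↔
    Nondeterministic.NP ⊆ Classes.P :=
  ⟨NP_subset_P_of_NP_subset_logAdvice, fun h _ hL => mem_logAdvice_of_mem_P (h hL)⟩

/-- **For an `NP`-complete length-paddable `T`: `T ∈ P/log ↔ NP ⊆ P`.**
[cite: KarpLipton1980, §6 (P/log)] -/
theorem mem_logAdvice_iff_of_isNPComplete_lengthPaddable {T : Language Bool}
    (hT : IsNPComplete T) (hpad : IsLengthPaddable T) :
    (∃ T' ∈ Classes.P, ∃ a : ℕ → List Bool, ∃ c : ℕ,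
      (∀ n, (a n).length ≤ c * Nat.log 2 n + c) ∧ ∀ y, y ∈ T ↔ boolPair y (a y.length) ∈ T') ↔
    Nondeterministic.NP ⊆ Classes.P :=
  ⟨NP_subset_P_of_isHard_lengthPaddable_logAdvice hT.2 hpad, fun h => mem_logAdvice_of_mem_P (h hT.1)⟩

/-- **`onesZeroPad SAT ∈ P/log ↔ NP ⊆ P`** — the padded satisfiability problem
`{1ⁱ 0 φ : φ ∈ SAT}` absorbs logarithmic advice. [cite: KarpLipton1980, §6 (P/log)] -/
theorem onesZeroPad_SAT_mem_logAdvice_iff :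
    (∃ T' ∈ Classes.P, ∃ a : ℕ → List Bool, ∃ c : ℕ,
      (∀ n, (a n).length ≤ c * Nat.log 2 n + c) ∧
        ∀ y, y ∈ onesZeroPad SAT ↔ boolPair y (a y.length) ∈ T') ↔
    Nondeterministic.NP ⊆ Classes.P :=
  mem_logAdvice_iff_of_isNPComplete_lengthPaddable (isNPComplete_onesZeroPad isNPComplete_SAT_holds)
    (isLengthPaddable_onesZeroPad SAT)

end Literature.Computability.Complexity
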